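import Summits.AtomisticToContinuum.Crystallization.Theorems.ThreeConeCertificateOnePercentCertificatePosTypeGaussBernstein
import Summits.AtomisticToContinuum.Crystallization.Theorems.ExactCertificate.Negative.SplitBasics

/-!
# `ExactCertificate` (stmt-AtomisticToContinuum-11959): the cone split is FEASIBLE — the stability
# clause carries the entire content

Line `closure-makes-nogap-exact`, load-bearing side (c1 lead).  The standing disproof analysis
(`Cruxes/ExactCertificate/Disproof.lean` §3) showed that the crux with the stability clause (S5) —
or the value equation (S6) — dropped is EXACTLY the bare feasibility of the three-cone split: the
existence of a radial positive-type `f` on `ℝ³` with `f ≤ V_LJ (< 0)` on a neighbourhood of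
infinity; it left this as a named hypothesis (`Feasible`), remarking that such `f` exist on paper
(`F(r) = (5 − r²)/(1 + r²)⁴`, a 3-D Fourier inversion).  This file DISCHARGES it inside the tree,
with no Fourier inversion of its own, using the Gaussian–Bernstein positive-type mechanism built
for the sibling crux `OnePercentCertificate` (`stub_posType_gaussBernstein`, Bochner in Bernstein
coordinates via `Coulomb.positiveType_points_nonneg`):

* `kernel r = 28·e^{−r²} − 28·∫₀¹ u² e^{−u r²} du` is radially of positive type on `ℝ³`
  (`kernel_posType`: its Gaussian symbol `28 e^{−s}` dominates its Bernstein symbol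
  `28 ∫₀¹ √u e^{−s/u} du ≤ 28 e^{−s}`), has `kernel 0 = 56/3 > 0`, and an `−r⁻⁶` tail:
  `∫₀¹ u² e^{−ur²} du ≥ 1/(24 r⁶)` for `r ≥ 1`, whence **`kernel ≤ V_LJ` on `[8, ∞)`**
  (`kernel_le_lennardJones`; `28 r⁶ ≤ r¹⁰/120 ≤ e^{r²}`);
* `exists_posType_le_lennardJones` — the feasibility statement;
* **`withoutStability`** — consequently the crux WITH THE STABILITY CLAUSE (S5) DROPPED holds for
  EVERY periodic template `P` and is therefore void: `V_LJ = g + U + f` on `(0,∞)` with `U ≥ 0`,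
  `g ≡ 0` on `[8,∞)`, `f` of positive type and `c + f 0/2 = −e(P)` (take `ρ = 8`, `f = kernel`,
  `U = (V_LJ − f)·1_{[8,∞)}`, `g = (V_LJ − f)·1_{(0,8)}`, `c = −e(P) − f 0/2`).  So, next to the
  finite range (S3) (Disproof: (S3) dropped ⇔ KeplerBound), the STABILITY of the finite-range
  remainder `g` is what carries the content of `ExactCertificate` — the formal version of "all the
  content sits in the core clause".

All `[folklore]`.
-/

noncomputable section

namespace Summit.AtomisticToContinuum.Crystallization.Theorems.ThreeConeCertificateExactCertificate.Feasible

open Literature.MathematicalPhysics.StatisticalMechanics MeasureTheory Real Set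
open scoped BigOperators


/-- **The kernel is radially of positive type on `ℝ³`** (Gaussian–Bernstein mechanism with one
Gaussian `α = 28, t = 1` and Bernstein tail `κ = 28, T = 1`; symbol domination
`28 ∫₀¹ √u e^{−s/u} du ≤ 28 e^{−s}` from `tailSymbol_le`). [folklore] -/
theorem kernel_posType : ∀ (n : ℕ) (y : Fin n → EuclideanSpace ℝ (Fin 3)) (w : Fin n → ℝ),
    0 ≤ ∑ i, ∑ j, w i * w j * (28 * Real.exp (-1 * dist (y i) (y j) ^ 2) - 28 * ∫ u in (0 : ℝ)..1, u ^ 2 * Real.exp (-u * dist (y i) (y j) ^ 2)) := by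
  intro n y w
  have hG : ∀ s : ℝ, 0 ≤ s → (28 : ℝ) * ∫ u in (0 : ℝ)..1, Real.sqrt u * Real.exp (-s / u) ≤
      ∑ m : Fin 1, (fun _ => (28 : ℝ)) m / Real.sqrt ((fun _ => (1 : ℝ)) m) ^ 3 *
        Real.exp (-s / (fun _ => (1 : ℝ)) m) := by
    intro s hs
    have h1 := PosTypeGaussBernstein.tailSymbol_le s 1 hs zero_le_one
    simp only [Real.sqrt_one, one_mul, div_one] at h1
    simp only [Fin.sum_univ_succ, Fin.sum_univ_zero, add_zero, Real.sqrt_one, one_pow, div_one]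
    linarith
  have h := stub_posType_gaussBernstein (M := 1) (fun _ => (28 : ℝ)) (fun _ => (1 : ℝ))
    (fun _ => one_pos) 28 1 (by norm_num) one_pos hG n y w
  simp only [Fin.sum_univ_succ, Fin.sum_univ_zero, add_zero] at h
  simpa only using h

/-- `∫₀¹ u² du = 1/3`, the Bernstein tail at `r = 0`. [folklore] -/
theorem integral_tail_zero : ∫ u in (0 : ℝ)..1, u ^ 2 * Real.exp (-u * (0 : ℝ) ^ 2) = 1 / 3 := by
  have h : (fun u : ℝ => u ^ 2 * Real.exp (-u * (0 : ℝ) ^ 2)) = fun u => u ^ 2 := by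
    funext u; simp
  rw [h, integral_pow]; norm_num

/-- `kernel 0 = 56/3 > 0`. [folklore] -/
theorem kernel_zero : (28 * Real.exp (-1 * (0 : ℝ) ^ 2) - 28 * ∫ u in (0 : ℝ)..1, u ^ 2 * Real.exp (-u * (0 : ℝ) ^ 2)) = 56 / 3 := by
  rw [integral_tail_zero]; norm_num

/-- **Lower bound on the Bernstein tail**: `1/(24 r⁶) ≤ ∫₀¹ u² e^{−u r²} du` for `r ≥ 1`
(restrict to `u ∈ [1/(2r²), 1/r²]`, where `u² ≥ 1/(4r⁴)` and `e^{−ur²} ≥ e⁻¹ ≥ 1/3`). [folklore] -/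
theorem integral_tail_ge {r : ℝ} (hr : 1 ≤ r) :
    1 / (24 * r ^ 6) ≤ ∫ u in (0 : ℝ)..1, u ^ 2 * Real.exp (-u * r ^ 2) := by
  have hr0 : 0 < r := lt_of_lt_of_le one_pos hr
  have hr2 : 1 ≤ r ^ 2 := one_le_pow₀ hr
  set a : ℝ := 1 / (2 * r ^ 2) with ha
  set b : ℝ := 1 / r ^ 2 with hb
  have hr2pos : 0 < r ^ 2 := by positivity
  have ha0 : 0 < a := by rw [ha]; positivity
  have hab : a ≤ b := by
    rw [ha, hb]; exact one_div_le_one_div_of_le hr2pos (by linarith)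
  have hb1 : b ≤ 1 := by rw [hb, div_le_one hr2pos]; exact hr2
  have hcont : Continuous fun u : ℝ => u ^ 2 * Real.exp (-u * r ^ 2) := by fun_prop
  have hnn : ∀ u, 0 ≤ u → 0 ≤ u ^ 2 * Real.exp (-u * r ^ 2) := fun u _ => by positivity
  -- restrict the integral to `[a, b]`
  have hmono : ∫ u in a..b, u ^ 2 * Real.exp (-u * r ^ 2) ≤
      ∫ u in (0 : ℝ)..1, u ^ 2 * Real.exp (-u * r ^ 2) := by
    refine intervalIntegral.integral_mono_interval ha0.le hab hb1 ?_ (hcont.intervalIntegrable _ _)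
    refine Filter.Eventually.of_forall fun u => ?_
    show 0 ≤ u ^ 2 * Real.exp (-u * r ^ 2)
    positivity
  -- on `[a, b]` the integrand is at least `a² e⁻¹`
  have hconst : ∫ _u in a..b, a ^ 2 * Real.exp (-1) ≤ ∫ u in a..b, u ^ 2 * Real.exp (-u * r ^ 2) := by
    refine intervalIntegral.integral_mono_on hab intervalIntegrable_const (hcont.intervalIntegrable _ _)
      fun u hu => ?_
    have hu0 : 0 ≤ u := ha0.le.trans hu.1
    have h1 : a ^ 2 ≤ u ^ 2 := pow_le_pow_left₀ ha0.le hu.1 2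
    have h2 : Real.exp (-1) ≤ Real.exp (-u * r ^ 2) := by
      rw [Real.exp_le_exp]
      have : u * r ^ 2 ≤ 1 := by
        calc u * r ^ 2 ≤ b * r ^ 2 := mul_le_mul_of_nonneg_right hu.2 hr2pos.le
          _ = 1 := by rw [hb]; field_simp
      linarith
    exact mul_le_mul h1 h2 (Real.exp_pos _).le (by positivity)
  rw [intervalIntegral.integral_const, smul_eq_mul] at hconst
  -- `(b − a) a² e⁻¹ = e⁻¹/(8 r⁶) ≥ 1/(24 r⁶)`
  have he : (1 : ℝ) / 3 ≤ Real.exp (-1) := by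
    rw [Real.exp_neg, le_inv_comm₀ (by norm_num) (Real.exp_pos 1)]
    have := Real.exp_one_lt_d9
    norm_num at this ⊢; linarith
  have hba : (b - a) * (a ^ 2 * Real.exp (-1)) = Real.exp (-1) / (8 * r ^ 6) := by
    rw [ha, hb]; field_simp; ring
  rw [hba] at hconst
  have hr6 : 0 < r ^ 6 := by positivity
  calc 1 / (24 * r ^ 6) ≤ Real.exp (-1) / (8 * r ^ 6) := by
        rw [div_le_div_iff₀ (by positivity) (by positivity)]; nlinarith
    _ ≤ _ := hconst.trans hmono

/-- **`kernel ≤ V_LJ` on `[8, ∞)`** (`28 e^{−r²} ≤ r⁻⁶` there, since `28 r⁶ ≤ r¹⁰/120 ≤ e^{r²}`).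
[folklore] -/
theorem kernel_le_lennardJones {r : ℝ} (hr : 8 ≤ r) :
    (28 * Real.exp (-1 * r ^ 2) - 28 * ∫ u in (0 : ℝ)..1, u ^ 2 * Real.exp (-u * r ^ 2)) ≤ lennardJones r := by
  have hr0 : 0 < r := lt_of_lt_of_le (by norm_num) hr
  have hr1 : 1 ≤ r := le_trans (by norm_num) hr
  have hI := integral_tail_ge hr1
  have hr6 : 0 < r ^ 6 := by positivity
  -- `28 e^{−r²} ≤ r⁻⁶`
  have hexp : 28 * Real.exp (-1 * r ^ 2) ≤ 1 / r ^ 6 := by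
    have h1 := Real.pow_div_factorial_le_exp (r ^ 2) (by positivity) 5
    have h5 : ((Nat.factorial 5 : ℕ) : ℝ) = 120 := by norm_num [Nat.factorial]
    rw [h5] at h1
    have hr2' : (64 : ℝ) ≤ r ^ 2 := by nlinarith
    have hr4 : (3360 : ℝ) ≤ r ^ 4 := by
      have : (64 : ℝ) ^ 2 ≤ (r ^ 2) ^ 2 := pow_le_pow_left₀ (by norm_num) hr2' 2
      nlinarith [this]
    have h2 : 28 * r ^ 6 ≤ Real.exp (r ^ 2) := by
      have : 28 * r ^ 6 ≤ (r ^ 2) ^ 5 / 120 := by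
        rw [le_div_iff₀ (by norm_num)]; nlinarith
      exact this.trans h1
    have hE := Real.exp_pos (r ^ 2)
    rw [show (-1 : ℝ) * r ^ 2 = -(r ^ 2) by ring, Real.exp_neg, ← div_eq_mul_inv,
      div_le_div_iff₀ hE hr6]
    linarith
  -- everything in terms of `t = r⁻⁶`
  set t : ℝ := 1 / r ^ 6 with ht
  have ht0 : 0 ≤ t := by positivity
  have hI' : (1 / 24) * t ≤ ∫ u in (0 : ℝ)..1, u ^ 2 * Real.exp (-u * r ^ 2) := by
    have : (1 : ℝ) / 24 * t = 1 / (24 * r ^ 6) := by rw [ht]; field_simp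
    rw [this]; exact hI
  have h6 : (r⁻¹) ^ 6 = t := by rw [ht, inv_pow, one_div]
  have h12 : (r⁻¹) ^ 12 = t ^ 2 := by
    rw [show (12 : ℕ) = 6 * 2 from rfl, pow_mul, h6]
  unfold lennardJones
  rw [h6, h12]
  nlinarith [hexp, hI', sq_nonneg t]

/-- **Feasibility of the cone split**: a radial positive-type `f` on `ℝ³` with `f 0 > 0` lying
below the Lennard-Jones potential on a neighbourhood of infinity. [folklore] -/
theorem exists_posType_le_lennardJones : ∃ f : ℝ → ℝ,
    (∀ (n : ℕ) (y : Fin n → EuclideanSpace ℝ (Fin 3)) (w : Fin n → ℝ),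
      0 ≤ ∑ i, ∑ j, w i * w j * f (dist (y i) (y j))) ∧
    0 < f 0 ∧ ∀ r : ℝ, 8 ≤ r → f r ≤ lennardJones r :=
  ⟨(fun r : ℝ => 28 * Real.exp (-1 * r ^ 2) - 28 * ∫ u in (0 : ℝ)..1, u ^ 2 * Real.exp (-u * r ^ 2)),
    kernel_posType, by simp only []; rw [kernel_zero]; norm_num, fun _ hr => kernel_le_lennardJones hr⟩

/-- **THE STABILITY CLAUSE IS LOAD-BEARING: with (S5) dropped the crux holds for EVERY template.**
For every periodic configuration `P` of `ℝ³` there are `ρ, c, g, U, f` with (S1) `V_LJ = g + U + f`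
on `(0,∞)`, (S2) `U ≥ 0`, (S3) `g ≡ 0` on `[ρ,∞)`, (S4) `f` radially of positive type, and (S6)
`c + f 0/2 = −e(P)` — everything in `ExactCertificate` except the `c`-stability of `g`.
(Disproof §3 `withoutStability_iff_feasible`, now unconditional.) [folklore] -/
theorem withoutStability (P : PeriodicConfiguration 3) :
    ∃ (ρ c : ℝ) (g U f : ℝ → ℝ),
      (∀ r : ℝ, 0 < r → lennardJones r = g r + U r + f r) ∧
      (∀ r : ℝ, 0 < r → 0 ≤ U r) ∧
      (∀ r : ℝ, ρ ≤ r → g r = 0) ∧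
      (∀ (n : ℕ) (y : Fin n → EuclideanSpace ℝ (Fin 3)) (w : Fin n → ℝ),
        0 ≤ ∑ i, ∑ j, w i * w j * f (dist (y i) (y j))) ∧
      c + f 0 / 2 = -(P.energyPerParticle lennardJones) := by
  refine ⟨8, -(P.energyPerParticle lennardJones) - (28 * Real.exp (-1 * (0 : ℝ) ^ 2) - 28 * ∫ u in (0 : ℝ)..1, u ^ 2 * Real.exp (-u * (0 : ℝ) ^ 2)) / 2,
    fun r => if r < 8 then lennardJones r - (28 * Real.exp (-1 * r ^ 2) - 28 * ∫ u in (0 : ℝ)..1, u ^ 2 * Real.exp (-u * r ^ 2)) else 0,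
    fun r => if r < 8 then 0 else lennardJones r - (28 * Real.exp (-1 * r ^ 2) - 28 * ∫ u in (0 : ℝ)..1, u ^ 2 * Real.exp (-u * r ^ 2)),
    (fun r : ℝ => 28 * Real.exp (-1 * r ^ 2) - 28 * ∫ u in (0 : ℝ)..1, u ^ 2 * Real.exp (-u * r ^ 2)), ?_, ?_, ?_, kernel_posType, ?_⟩
  · intro r _
    show lennardJones r = (if r < 8 then lennardJones r - (28 * Real.exp (-1 * r ^ 2) - 28 * ∫ u in (0 : ℝ)..1, u ^ 2 * Real.exp (-u * r ^ 2)) else 0) +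
      (if r < 8 then 0 else lennardJones r - (28 * Real.exp (-1 * r ^ 2) - 28 * ∫ u in (0 : ℝ)..1, u ^ 2 * Real.exp (-u * r ^ 2))) + (28 * Real.exp (-1 * r ^ 2) - 28 * ∫ u in (0 : ℝ)..1, u ^ 2 * Real.exp (-u * r ^ 2))
    split_ifs <;> ring
  · intro r _
    show 0 ≤ (if r < 8 then 0 else lennardJones r - (28 * Real.exp (-1 * r ^ 2) - 28 * ∫ u in (0 : ℝ)..1, u ^ 2 * Real.exp (-u * r ^ 2)))
    split_ifs with h
    · exact le_rfl
    · exact sub_nonneg.2 (kernel_le_lennardJones (not_lt.1 h))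
  · intro r hr
    show (if r < 8 then lennardJones r - (28 * Real.exp (-1 * r ^ 2) - 28 * ∫ u in (0 : ℝ)..1, u ^ 2 * Real.exp (-u * r ^ 2)) else 0) = 0
    rw [if_neg (not_lt.2 hr)]
  · show -(P.energyPerParticle lennardJones) - (28 * Real.exp (-1 * (0 : ℝ) ^ 2) - 28 * ∫ u in (0 : ℝ)..1, u ^ 2 * Real.exp (-u * (0 : ℝ) ^ 2)) / 2 +
      (28 * Real.exp (-1 * (0 : ℝ) ^ 2) - 28 * ∫ u in (0 : ℝ)..1, u ^ 2 * Real.exp (-u * (0 : ℝ) ^ 2)) / 2 = -(P.energyPerParticle lennardJones)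
    ring

/-- The same with the value written as an inequality `c + f 0/2 ≤ −e(P)` and ANY prescribed
constant on the right: without stability the "value" of a split is meaningless. [folklore] -/
theorem withoutStability_le (P : PeriodicConfiguration 3) (v : ℝ) :
    ∃ (ρ c : ℝ) (g U f : ℝ → ℝ),
      (∀ r : ℝ, 0 < r → lennardJones r = g r + U r + f r) ∧
      (∀ r : ℝ, 0 < r → 0 ≤ U r) ∧
      (∀ r : ℝ, ρ ≤ r → g r = 0) ∧
      (∀ (n : ℕ) (y : Fin n → EuclideanSpace ℝ (Fin 3)) (w : Fin n → ℝ),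
        0 ≤ ∑ i, ∑ j, w i * w j * f (dist (y i) (y j))) ∧
      c + f 0 / 2 ≤ v ∧ c + f 0 / 2 ≤ -(P.energyPerParticle lennardJones) := by
  obtain ⟨ρ, c, g, U, f, h1, h2, h3, h4, h5⟩ := withoutStability P
  refine ⟨ρ, min c (v - f 0 / 2), g, U, f, h1, h2, h3, h4, ?_, ?_⟩
  · linarith [min_le_right c (v - f 0 / 2)]
  · linarith [min_le_left c (v - f 0 / 2)]

/-- **Registered stub `stub_withoutStability` of crux item stmt-AtomisticToContinuum-11959** (line
`closure-makes-nogap-exact`, load-bearing side; signature verbatim) = `withoutStability`. [folklore] -/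
theorem stub_withoutStability : ∀ P : PeriodicConfiguration 3, ∃ (ρ c : ℝ) (g U f : ℝ → ℝ),
    (∀ r : ℝ, 0 < r → lennardJones r = g r + U r + f r) ∧ (∀ r : ℝ, 0 < r → 0 ≤ U r) ∧
    (∀ r : ℝ, ρ ≤ r → g r = 0) ∧
    (∀ (n : ℕ) (y : Fin n → EuclideanSpace ℝ (Fin 3)) (w : Fin n → ℝ),
      0 ≤ ∑ i, ∑ j, w i * w j * f (dist (y i) (y j))) ∧
    c + f 0 / 2 = -(P.energyPerParticle lennardJones) :=
  withoutStability

end Summit.AtomisticToContinuum.Crystallization.Theorems.ThreeConeCertificateExactCertificate.Feasible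

end
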